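import Literature.Analysis.FluidPDE.SwirlMaximumPrinciple
import HarnessLib

/-!
# Route CorkscrewDynamo · crux `CorkscrewProfile` (stmt-NavierStokesRegularity-11282) — stub S3
# `stub_ancientSubsolutionNonpos`: ancient subsolutions of a drift–heat equation with Type-I drift die

Stub `stub_ancientSubsolutionNonpos` of line `registered` (skeleton v17, lead c7): the parabolic
Liouville/comparison step of the STRETCHING NECESSITY block. Let `w : (−∞, 0) × ℝ³ → ℝ` have `C²`
slices, be jointly continuous, be differentiable in time with derivative `wₜ`, and satisfy the
differential inequality `wₜ ≤ Δw − Dw[V]` with a drift obeying the Type-I bound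
`‖V(t, x)‖ ≤ C₀/√(−t)`. If `w(t, ·) ≤ b(t)` with `b` monotone on `(−∞, 0)` and `b(t) → 0` as
`t → −∞`, then `w ≤ 0`.

Proof (the pattern of `tangentDrift_le_barrier` / `tangentDrift_nonpos` of
`CorkscrewDynamoSphereTangentLiouvilleMaxPrinciple`). Fix `t₀ < t₁ < 0`. On the slab `[t₀, t₁]`
the drift is bounded, `‖V‖ ≤ M := C₀/√(−t₁)`, and for `μ ≥ 7 + M²` the function
`B(t, x) = B₀ + ε e^{μ(t−t₀)}(1 + |x|²)` is a supersolution: at a critical point of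
`w(t, ·) − B(t, ·)` with `Δ(w − B) ≤ 0` one has `∇w = 2c⟪x, ·⟫`, `Δw ≤ 6c` (`c = ε e^{μ(t−t₀)}`;
`hasFDerivAt_barrier`, `laplacian_barrier`), so `wₜ ≤ Δw − 2c⟪x, V⟫ ≤ 6c + 2cM|x| ≤
(7 + M²) c (1 + |x|²) ≤ Bₜ`. On the bottom `w(t₀, ·) ≤ b(t₀) = B₀ ≤ B`; on a large sphere
`|x| = R`, `R² ≥ (b(t₁) − b(t₀))/ε`, `w ≤ b(t₁) ≤ B`. The tree's weak parabolic maximum principle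
(`weak_max_principle`, Lieberman 1996, Ch. II, Lemma 2.1 / 2.3) on `[t₀, t₁] × B̄(0, R)` gives
`w(t₁, x₁) ≤ b(t₀) + ε e^{μ(t₁−t₀)}(1 + |x₁|²)`; let `ε → 0`, then `t₀ → −∞`.

* `subsolution_le_barrier_slab` — the comparison on a slab `[t₀, t₁]` with a bounded drift;
* `ancientSubsolution_le_bound_bottom` — `w(t₁, x₁) ≤ b(t₀)` for `t₀ < t₁ < 0`;
* `stub_ancientSubsolutionNonpos` — `w ≤ 0`.
-/

noncomputable section

open MeasureTheory Set Function Filter InnerProductSpace Metric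
open scoped RealInnerProductSpace Topology Laplacian
open Literature.Analysis Literature.Analysis.FluidPDE

namespace Summit.NavierStokesRegularity.NavierStokesRegularity.Theorems.CorkscrewProfile.Birth

set_option linter.dupNamespace false

/-- The constant of a Type-I drift bound `‖V(t, x)‖ ≤ C₀/√(−t)` on `(−∞, 0) × ℝ³` is
nonnegative (evaluate at `t = −1`). [folklore] -/
theorem const_nonneg_of_norm_le_div_sqrt
    {V : ℝ → EuclideanSpace ℝ (Fin 3) → EuclideanSpace ℝ (Fin 3)} {C₀ : ℝ}
    (hV : ∀ t < 0, ∀ x, ‖V t x‖ ≤ C₀ / Real.sqrt (-t)) : 0 ≤ C₀ := by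
  have h := hV (-1) (by norm_num) 0
  rw [neg_neg, Real.sqrt_one, div_one] at h
  exact (norm_nonneg _).trans h

/-- **Comparison with the quadratic barrier on a slab.** Let `w` be jointly continuous on
`[t₀, t₁] × ℝ³` with `C²` slices and time derivative `wₜ`, and satisfy `wₜ ≤ Δw − Dw[V]` with a
bounded drift `‖V‖ ≤ M` on the slab. If `w(t₀, ·) ≤ B₀` and `w ≤ B₁` on the slab, then for
`μ ≥ 7 + M²`, `ε > 0` and every `x₁`, `w(t₁, x₁) ≤ B₀ + ε e^{μ(t₁−t₀)}(1 + |x₁|²)`: the weak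
parabolic maximum principle `weak_max_principle` on `[t₀, t₁] × B̄(0, R)`,
`R² ≥ (B₁ − B₀)/ε`, applied to `w − B₀ − ε e^{μ(t−t₀)}(1 + |x|²)` (a sub-solution at its critical
points since `6 + 2M|x| ≤ (7 + M²)(1 + |x|²)`). [cite: Lieberman1996, Ch. II Lemma 2.1 and Lemma 2.3] -/
theorem subsolution_le_barrier_slab
    {w wt : ℝ → EuclideanSpace ℝ (Fin 3) → ℝ}
    {V : ℝ → EuclideanSpace ℝ (Fin 3) → EuclideanSpace ℝ (Fin 3)} {t₀ t₁ M μ B₀ B₁ ε : ℝ}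
    (h01 : t₀ ≤ t₁)
    (hw2 : ∀ t ∈ Icc t₀ t₁, ContDiff ℝ 2 (w t))
    (hwc : ContinuousOn (uncurry w) (Icc t₀ t₁ ×ˢ univ))
    (hwt : ∀ t ∈ Icc t₀ t₁, ∀ x, HasDerivAt (fun s => w s x) (wt t x) t)
    (hsub : ∀ t ∈ Icc t₀ t₁, ∀ x, wt t x ≤ (Δ (w t)) x - fderiv ℝ (w t) x (V t x))
    (hVM : ∀ t ∈ Icc t₀ t₁, ∀ x, ‖V t x‖ ≤ M)
    (hbot : ∀ x, w t₀ x ≤ B₀)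
    (hlat : ∀ t ∈ Icc t₀ t₁, ∀ x, w t x ≤ B₁)
    (hμ : 7 + M ^ 2 ≤ μ) (hε : 0 < ε) (x₁ : EuclideanSpace ℝ (Fin 3)) :
    w t₁ x₁ ≤ B₀ + ε * Real.exp (μ * (t₁ - t₀)) * (1 + ‖x₁‖ ^ 2) := by
  have hμ0 : 0 ≤ μ := le_trans (by positivity) hμ
  -- the radius of the ball
  set R : ℝ := max ‖x₁‖ (Real.sqrt ((B₁ - B₀) / ε)) with hR
  have hx₁R : ‖x₁‖ ≤ R := le_max_left _ _
  have hR2 : (B₁ - B₀) / ε ≤ R ^ 2 :=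
    (Real.sqrt_le_iff.1 (le_max_right ‖x₁‖ (Real.sqrt ((B₁ - B₀) / ε)))).2
  have hR2' : B₁ - B₀ ≤ ε * R ^ 2 := by
    rw [div_le_iff₀ hε] at hR2
    linarith
  -- the comparison function and its time derivative
  set Z : ℝ → EuclideanSpace ℝ (Fin 3) → ℝ := fun t x =>
    w t x - (B₀ + ε * Real.exp (μ * (t - t₀)) * (1 + ‖x‖ ^ 2)) with hZ
  set Zₜ : ℝ → EuclideanSpace ℝ (Fin 3) → ℝ := fun t x =>
    wt t x - μ * (ε * Real.exp (μ * (t - t₀))) * (1 + ‖x‖ ^ 2) with hZₜ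
  have hZfun : ∀ t, Z t = fun x =>
      w t x - (B₀ + ε * Real.exp (μ * (t - t₀)) * (1 + ‖x‖ ^ 2)) := fun t => rfl
  set K : Set (EuclideanSpace ℝ (Fin 3)) := closedBall 0 R with hK
  set U : Set (EuclideanSpace ℝ (Fin 3)) := ball 0 R with hU
  have hKcpt : IsCompact K := isCompact_closedBall _ _
  have hUo : IsOpen U := isOpen_ball
  have hUK : U ⊆ K := ball_subset_closedBall
  -- (a) joint continuity on `[t₀, t₁] × K`
  have hc : ContinuousOn (uncurry Z) (Icc t₀ t₁ ×ˢ K) := by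
    have hwc' : ContinuousOn (uncurry w) (Icc t₀ t₁ ×ˢ K) :=
      hwc.mono (prod_mono Subset.rfl (subset_univ _))
    have h2 : Continuous fun p : ℝ × EuclideanSpace ℝ (Fin 3) =>
        B₀ + ε * Real.exp (μ * (p.1 - t₀)) * (1 + ‖p.2‖ ^ 2) := by
      fun_prop
    exact hwc'.sub h2.continuousOn
  -- (b) smooth slices
  have h2 : ∀ t ∈ Ioc t₀ t₁, ContDiff ℝ 2 (Z t) := by
    intro t ht
    rw [hZfun t]
    exact (hw2 t ⟨ht.1.le, ht.2⟩).sub (contDiff_barrier _ _)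
  -- (c) the time derivative
  have ht : ∀ t ∈ Ioc t₀ t₁, ∀ x ∈ U,
      HasDerivWithinAt (fun s => Z s x) (Zₜ t x) (Icc t₀ t) t := by
    intro t ht x _
    have hd : HasDerivAt (fun s => B₀ + ε * Real.exp (μ * (s - t₀)) * (1 + ‖x‖ ^ 2))
        (ε * (Real.exp (μ * (t - t₀)) * μ) * (1 + ‖x‖ ^ 2)) t := by
      have h := (((hasDerivAt_id t).sub_const t₀).const_mul μ).exp
      have := ((h.const_mul ε).mul_const (1 + ‖x‖ ^ 2)).const_add B₀
      simpa using this
    have h := ((hwt t ⟨ht.1.le, ht.2⟩ x).sub hd).hasDerivWithinAt (s := Icc t₀ t)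
    simp only [hZ, hZₜ]
    exact h.congr_deriv (by ring)
  -- (d) the sub-solution implication
  have hsub' : ∀ t ∈ Ioc t₀ t₁, ∀ x ∈ U,
      fderiv ℝ (Z t) x = 0 → (Δ (Z t)) x ≤ 0 → Zₜ t x ≤ 0 := by
    intro t ht x _ hgrad hlap
    have htI : t ∈ Icc t₀ t₁ := ⟨ht.1.le, ht.2⟩
    set c : ℝ := ε * Real.exp (μ * (t - t₀)) with hc
    have hc0 : 0 < c := by positivity
    have hwd : DifferentiableAt ℝ (w t) x :=
      ((hw2 t htI).differentiable (by norm_num)) x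
    have hB := hasFDerivAt_barrier B₀ c x
    have hZderiv : HasFDerivAt (Z t) (fderiv ℝ (w t) x -
        c • ((2 : ℕ) • (innerSL ℝ x : EuclideanSpace ℝ (Fin 3) →L[ℝ] ℝ))) x := by
      rw [hZfun t]
      exact hwd.hasFDerivAt.sub hB
    have hDeq : fderiv ℝ (w t) x =
        c • ((2 : ℕ) • (innerSL ℝ x : EuclideanSpace ℝ (Fin 3) →L[ℝ] ℝ)) := by
      have := hZderiv.fderiv
      rw [hgrad] at this
      exact sub_eq_zero.1 this.symm
    have hDV : fderiv ℝ (w t) x (V t x) = c * (2 * ⟪x, V t x⟫) := by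
      have := congrArg (fun L : EuclideanSpace ℝ (Fin 3) →L[ℝ] ℝ => L (V t x)) hDeq
      simpa [innerSL_apply_apply, nsmul_eq_mul] using this
    have hΔeq : (Δ (Z t)) x = (Δ (w t)) x - 6 * c := by
      have h1 : ContDiffAt ℝ 2 (w t) x := (hw2 t htI).contDiffAt
      have h2 : ContDiffAt ℝ 2
          (fun y : EuclideanSpace ℝ (Fin 3) => (B₀ + c * (1 + ‖y‖ ^ 2) : ℝ)) x :=
        (contDiff_barrier B₀ c).contDiffAt
      have h4 := h1.laplacian_sub h2
      have hfun : Z t =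
          (w t) - fun y : EuclideanSpace ℝ (Fin 3) => (B₀ + c * (1 + ‖y‖ ^ 2) : ℝ) := by
        rw [hZfun t]; rfl
      rw [hfun, h4, laplacian_barrier]
    have hΔ : (Δ (w t)) x ≤ 6 * c := by rw [hΔeq] at hlap; linarith
    -- the drift term at the critical point: `-Dw[V] = -2c⟪x, V⟫ ≤ 2cM|x|`
    have hconv : -(c * (2 * ⟪x, V t x⟫)) ≤ c * (2 * (‖x‖ * M)) := by
      have h1 : |⟪x, V t x⟫| ≤ ‖x‖ * ‖V t x‖ := abs_real_inner_le_norm _ _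
      have h2 : ‖x‖ * ‖V t x‖ ≤ ‖x‖ * M :=
        mul_le_mul_of_nonneg_left (hVM t htI x) (norm_nonneg _)
      have h3 := (abs_le.1 (h1.trans h2)).1
      nlinarith
    -- `wₜ ≤ 6c + 2cM|x| ≤ (7 + M²) c (1 + |x|²) ≤ μ c (1 + |x|²)`
    have hwt_le : wt t x ≤ 6 * c + c * (2 * (‖x‖ * M)) := by
      have h := hsub t htI x
      rw [hDV] at h
      linarith
    have hx2 : c * (2 * (‖x‖ * M)) ≤ c * (M ^ 2 + ‖x‖ ^ 2) := by
      refine mul_le_mul_of_nonneg_left ?_ hc0.le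
      nlinarith [sq_nonneg (M - ‖x‖)]
    have hkey : 6 * c + c * (M ^ 2 + ‖x‖ ^ 2) ≤ μ * c * (1 + ‖x‖ ^ 2) := by
      have e : (7 + M ^ 2) * c * (1 + ‖x‖ ^ 2) =
          6 * c + c * (M ^ 2 + ‖x‖ ^ 2) + (c + 6 * (c * ‖x‖ ^ 2) + c * M ^ 2 * ‖x‖ ^ 2) := by
        ring
      have h1 : 0 ≤ c * ‖x‖ ^ 2 := by positivity
      have h2 : 0 ≤ c * M ^ 2 * ‖x‖ ^ 2 := by positivity
      have h3 : (7 + M ^ 2) * c * (1 + ‖x‖ ^ 2) ≤ μ * c * (1 + ‖x‖ ^ 2) := by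
        have : (7 + M ^ 2) * (c * (1 + ‖x‖ ^ 2)) ≤ μ * (c * (1 + ‖x‖ ^ 2)) :=
          mul_le_mul_of_nonneg_right hμ (by positivity)
        simpa only [mul_assoc] using this
      linarith
    have e3 : Zₜ t x = wt t x - μ * c * (1 + ‖x‖ ^ 2) := by
      simp only [hZₜ, hc]
    rw [e3]
    linarith
  -- (e) the bottom `t = t₀`
  have hbot' : ∀ x ∈ K, Z t₀ x ≤ 0 := by
    intro x _
    have h1 := hbot x
    have h4 : 0 ≤ ε * Real.exp (μ * (t₀ - t₀)) * (1 + ‖x‖ ^ 2) := by positivity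
    simp only [hZ]
    linarith
  -- (f) the sphere `|x| = R`
  have hlat' : ∀ t ∈ Icc t₀ t₁, ∀ x ∈ K \ U, Z t x ≤ 0 := by
    intro t ht x hx
    have hxR : ‖x‖ = R := by
      have h1 : ‖x‖ ≤ R := mem_closedBall_zero_iff.1 hx.1
      have h2 : R ≤ ‖x‖ := by simpa [hU] using hx.2
      exact le_antisymm h1 h2
    have h1 := hlat t ht x
    have hexp : 1 ≤ Real.exp (μ * (t - t₀)) :=
      Real.one_le_exp (mul_nonneg hμ0 (by linarith [ht.1]))
    have h3 : ε * (1 + R ^ 2) ≤ ε * Real.exp (μ * (t - t₀)) * (1 + ‖x‖ ^ 2) := by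
      rw [hxR]
      calc ε * (1 + R ^ 2) = ε * 1 * (1 + R ^ 2) := by ring
        _ ≤ ε * Real.exp (μ * (t - t₀)) * (1 + R ^ 2) := by
          apply mul_le_mul_of_nonneg_right _ (by positivity)
          exact mul_le_mul_of_nonneg_left hexp hε.le
    simp only [hZ]
    nlinarith
  have key := weak_max_principle hKcpt hUo hUK hc h2 ht hsub' hbot' hlat' t₁
    ⟨h01, le_rfl⟩ x₁ (mem_closedBall_zero_iff.2 hx₁R)
  simp only [hZ] at key
  linarith

/-- **`w(t₁, x₁) ≤ b(t₀)`.** Under the hypotheses of `stub_ancientSubsolutionNonpos` (without the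
limit `b → 0`), for `t₀ < t₁ < 0` and every `x₁`, `w(t₁, x₁) ≤ b(t₀)`: on the slab `[t₀, t₁]`
the drift is bounded by `M = C₀/√(−t₁)`, `w(t₀, ·) ≤ b(t₀)` and `w ≤ b(t₁)` (monotonicity of
`b`), so `subsolution_le_barrier_slab` gives `w(t₁, x₁) ≤ b(t₀) + ε e^{(7+M²)(t₁−t₀)}(1 + |x₁|²)`
for every `ε > 0`. [cite: Lieberman1996, Ch. II Lemma 2.1 and Lemma 2.3] -/
theorem ancientSubsolution_le_bound_bottom {w wt : ℝ → EuclideanSpace ℝ (Fin 3) → ℝ}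
    {V : ℝ → EuclideanSpace ℝ (Fin 3) → EuclideanSpace ℝ (Fin 3)} {C₀ : ℝ} {b : ℝ → ℝ}
    (hw2 : ∀ t < 0, ContDiff ℝ 2 (w t))
    (hwc : ContinuousOn (Function.uncurry w) (Set.Iio 0 ×ˢ Set.univ))
    (hwt : ∀ t < 0, ∀ x, HasDerivAt (fun s => w s x) (wt t x) t)
    (hsub : ∀ t < 0, ∀ x, wt t x ≤ (Δ (w t)) x - fderiv ℝ (w t) x (V t x))
    (hV : ∀ t < 0, ∀ x, ‖V t x‖ ≤ C₀ / Real.sqrt (-t))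
    (hbd : ∀ t < 0, ∀ x, w t x ≤ b t)
    (hb : MonotoneOn b (Set.Iio 0))
    {t₀ t₁ : ℝ} (h01 : t₀ < t₁) (ht₁ : t₁ < 0) (x₁ : EuclideanSpace ℝ (Fin 3)) :
    w t₁ x₁ ≤ b t₀ := by
  have ht₀ : t₀ < 0 := h01.trans ht₁
  have hnt₁ : 0 < -t₁ := by linarith
  have hC₀ : 0 ≤ C₀ := const_nonneg_of_norm_le_div_sqrt hV
  have hI : ∀ t ∈ Icc t₀ t₁, t < 0 := fun t ht => lt_of_le_of_lt ht.2 ht₁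
  -- the hypotheses on the slab `[t₀, t₁]`
  have hw2' : ∀ t ∈ Icc t₀ t₁, ContDiff ℝ 2 (w t) := fun t ht => hw2 t (hI t ht)
  have hwc' : ContinuousOn (uncurry w) (Icc t₀ t₁ ×ˢ univ) :=
    hwc.mono (prod_mono (fun t ht => hI t ht) Subset.rfl)
  have hwt' : ∀ t ∈ Icc t₀ t₁, ∀ x, HasDerivAt (fun s => w s x) (wt t x) t :=
    fun t ht x => hwt t (hI t ht) x
  have hsub' : ∀ t ∈ Icc t₀ t₁, ∀ x, wt t x ≤ (Δ (w t)) x - fderiv ℝ (w t) x (V t x) :=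
    fun t ht x => hsub t (hI t ht) x
  have hVM : ∀ t ∈ Icc t₀ t₁, ∀ x, ‖V t x‖ ≤ C₀ / Real.sqrt (-t₁) := by
    intro t ht x
    refine (hV t (hI t ht) x).trans ?_
    exact div_le_div_of_nonneg_left hC₀ (Real.sqrt_pos.2 hnt₁)
      (Real.sqrt_le_sqrt (by linarith [ht.2]))
  have hbot : ∀ x, w t₀ x ≤ b t₀ := fun x => hbd t₀ ht₀ x
  have hlat : ∀ t ∈ Icc t₀ t₁, ∀ x, w t x ≤ b t₁ := fun t ht x =>
    (hbd t (hI t ht) x).trans (hb (show t ∈ Iio 0 from hI t ht) (show t₁ ∈ Iio 0 from ht₁) ht.2)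
  -- let `ε → 0`
  refine le_of_forall_pos_le_add fun η hη => ?_
  set e : ℝ := Real.exp ((7 + (C₀ / Real.sqrt (-t₁)) ^ 2) * (t₁ - t₀)) * (1 + ‖x₁‖ ^ 2) with he
  have he0 : 0 < e := by positivity
  have key := subsolution_le_barrier_slab h01.le hw2' hwc' hwt' hsub' hVM hbot hlat le_rfl
    (div_pos hη he0) x₁
  have h2 : η / e * Real.exp ((7 + (C₀ / Real.sqrt (-t₁)) ^ 2) * (t₁ - t₀)) * (1 + ‖x₁‖ ^ 2)
      = η := by
    rw [mul_assoc, ← he]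
    field_simp
  linarith

/-- **Stub S3 `stub_ancientSubsolutionNonpos` — ancient subsolutions die** (line `registered` of
crux stmt-NavierStokesRegularity-11282). Let `w` have `C²` slices, be jointly continuous on
`(−∞, 0) × ℝ³`, be differentiable in time with derivative `wₜ`, and satisfy the differential
inequality `wₜ ≤ Δw − Dw[V]` with a drift obeying the Type-I bound `‖V(t, x)‖ ≤ C₀/√(−t)`; if
`w(t, x) ≤ b(t)` with `b` monotone on `(−∞, 0)` and `b(t) → 0` as `t → −∞`, then `w ≤ 0`:
`w(t₁, x₁) ≤ b(t₀)` for every `t₀ < t₁` (`ancientSubsolution_le_bound_bottom`, the weak parabolic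
maximum principle with the barrier `b(t₀) + ε e^{μ(t−t₀)}(1 + |x|²)`), and `b(t₀) → 0`.
[cite: Lieberman1996, Ch. II Lemma 2.1 and Lemma 2.3] -/
theorem stub_ancientSubsolutionNonpos {w wt : ℝ → EuclideanSpace ℝ (Fin 3) → ℝ}
    {V : ℝ → EuclideanSpace ℝ (Fin 3) → EuclideanSpace ℝ (Fin 3)} {C₀ : ℝ} {b : ℝ → ℝ}
    (hw2 : ∀ t < 0, ContDiff ℝ 2 (w t))
    (hwc : ContinuousOn (Function.uncurry w) (Set.Iio 0 ×ˢ Set.univ))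
    (hwt : ∀ t < 0, ∀ x, HasDerivAt (fun s => w s x) (wt t x) t)
    (hsub : ∀ t < 0, ∀ x, wt t x ≤ (Δ (w t)) x - fderiv ℝ (w t) x (V t x))
    (hV : ∀ t < 0, ∀ x, ‖V t x‖ ≤ C₀ / Real.sqrt (-t))
    (hbd : ∀ t < 0, ∀ x, w t x ≤ b t)
    (hb : MonotoneOn b (Set.Iio 0))
    (hb0 : Filter.Tendsto b Filter.atBot (nhds 0)) :
    ∀ t < 0, ∀ x, w t x ≤ 0 := by
  intro t₁ ht₁ x₁
  refine ge_of_tendsto hb0 ?_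
  filter_upwards [eventually_lt_atBot t₁] with t₀ h01
  exact ancientSubsolution_le_bound_bottom hw2 hwc hwt hsub hV hbd hb h01 ht₁ x₁

end Summit.NavierStokesRegularity.NavierStokesRegularity.Theorems.CorkscrewProfile.Birth

end
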